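import Summits.AtomisticToContinuum.HydrodynamicLimit.Theorems.AntiMazurCoboundariesCorrectorPressureDecayEquivalences
import Summits.AtomisticToContinuum.HydrodynamicLimit.Theorems.AntiMazurCoboundariesCorrectorPressureDecayAlmostStationaryTimeAverage
import Summits.AtomisticToContinuum.HydrodynamicLimit.Theorems.AntiMazurCoboundariesCorrectorPressureDecayTiltedKL
import Summits.AtomisticToContinuum.HydrodynamicLimit.Theorems.AntiMazurCoboundariesCorrectorPressureDecayTimeAveragedLaw
import Summits.AtomisticToContinuum.HydrodynamicLimit.Theorems.AntiMazurCoboundariesCorrectorPressureDecayWindowFunctional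
import Summits.AtomisticToContinuum.HydrodynamicLimit.Theorems.JParityClosureOddContactSymmetryGibbsInvariance
import Literature.MathematicalPhysics.KineticTheory.HardSphereEulerProofs
import Literature.MathematicalPhysics.KineticTheory.HardSphereBBGKYLiouvilleFlow
import Literature.MathematicalPhysics.KineticTheory.HardSphereTwoTimePressure
import Literature.Probability.Divergences.KLDivConvexity
import Mathlib.MeasureTheory.Measure.Tilted
import Mathlib.InformationTheory.KullbackLeibler.Basic

/-!
# Kifer's finite-volume upper bound and the almost-stationary normal form of the crux —
line `FirstLemma` (idea `kifer-compactification`), crux stmt-AtomisticToContinuum-14135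
`AntiMazurCoboundaries.CorrectorPressureDecay` ("X")

Lead seat a1 (prover-line-stmt-AtomisticToContinuum-14135-a1-0). This file
* POSITS `AlmostStationaryDualDecay` (ASDD), the finite-`N` shadow of the line's transferred statement (the
  Entropic Boltzmann Property): in the frame of `KineticFluxLdDecay` (stmt-10967), for `N ≥ N₀` every probability
  law `Q` with `KL(Q ‖ G_N) < ∞` that is `η`-almost stationary in microscopic time has fast one-body bias at most
  `KL(Q ‖ G_N) + δ(N+1)`;
* PROVES the registered stub `stub_reduction : AlmostStationaryDualDecay → KineticFluxLdDecay` — KIFER'S UPPER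
  BOUND at finite volume [Kifer 1990, Thm 2.1, the mechanism]: with `A` the window functional (jointly measurable
  form, `stub_windowFunctional`), `Q* = G_N.tilted A` and `Q̄ = Ψ_#(U_{(0,h]} ⊗ Q*)` its time average,
  `log ∫ e^{A} dG_N = ∫ A dQ* − KL(Q*‖G_N)` (`stub_tiltedKL`) `= ∫ F dQ̄ − KL(Q*‖G_N)` (Fubini)
  `≤ ∫ F dQ̄ − KL(Q̄‖G_N)` (`stub_timeAveragedLaw` + flow-invariance of `G_N`), and `Q̄` is `(2/τ)`-almost
  stationary in microscopic time (`stub_almostStationaryTimeAverage` + `flow_add`), so ASDD with `η = 2/τ`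
  bounds the pressure by `δ(N+1)`;
* PROVES the converse `almostStationaryDualDecay_of_kineticFluxLdDecay` (Donsker–Varadhan inequality
  `∫ A dQ ≤ KL(Q‖G_N) + log ∫ e^{A} dG_N` plus almost-stationarity `∫ A dQ ≥ ∫ F dQ − ητκ(N+1)`), hence
  `almostStationaryDualDecay_iff_kineticFluxLdDecay` and, through the landed
  `correctorPressureDecay_iff_kineticFluxLdDecay` (p99142), `almostStationaryDualDecay_iff_correctorPressureDecay`:
  ASDD is a kernel-checked NORMAL FORM of the crux at finite `N` — every gram of content the line can add lives at
  `N = ∞` (the registered walls `stub_kiferBridge : EntropicBoltzmannProperty → AlmostStationaryDualDecay` and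
  `stub_entropicBoltzmannProperty` of the skeleton `Cruxes/CorrectorPressureDecay/Lines/FirstLemma.lean`).

Deliberately NOT here: the Entropic Boltzmann Property itself and the compactness bridge (infinite volume).
-/

noncomputable section

open MeasureTheory ProbabilityTheory Set

namespace Summit.AtomisticToContinuum.HydrodynamicLimit.Theorems.KiferCompactification

open Literature.MathematicalPhysics.KineticTheory (T3 V3 hsDiameter localGibbsLaw)
open Literature.Analysis.FluidPDE (HardSphereFlow Config)
open Summit.AtomisticToContinuum.HydrodynamicLimit.Theses.AntiMazurCoboundaries (CorrectorPressureDecay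
  KineticFluxLdDecay)

/-- **Almost-stationary dual decay** (ASDD) — the finite-`N` shadow of the Entropic Boltzmann Property, in the
frame of `KineticFluxLdDecay`: for constant profiles `(a, u₀, θ)` and `σ < σ₀` the global Gibbs laws `G_N` are
probability measures and there is an amplitude `κ > 0` such that for all admissible `(φ, g)` (`|φ| ≤ 1`,
`|g| ≤ κ`, `g ⊥ span(1, v, |v|²)` in `L²(stdGaussian)`) and every `δ > 0` there are a rate `η > 0` and `N₀`
with: for `N ≥ N₀`, every hard-sphere flow `Φ` and every probability law `Q` on phase space with
`KL(Q ‖ G_N) < ∞` which is `η`-ALMOST STATIONARY IN MICROSCOPIC TIME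
(`|E_Q[f ∘ Φ_u] − E_Q[f]| ≤ η · (u (N+1)^{1/3}) · C` for all bounded measurable `f`, `|f| ≤ C`, `u ≥ 0`),
the fast one-body bias is priced by the entropy: `E_Q[Σᵢ φ(xᵢ) g((vᵢ − u₀)/√θ)] − KL(Q ‖ G_N) ≤ δ (N+1)`.
By `almostStationaryDualDecay_iff_correctorPressureDecay` below it is EQUIVALENT to the crux: a statement POSITED by
line `FirstLemma` of crux stmt-AtomisticToContinuum-14135 (the hypothesis of its registered stub `stub_reduction`
and the conclusion of its wall `stub_kiferBridge`); not a literature fact. -/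
def AlmostStationaryDualDecay : Prop :=
  ∀ (a θ : ℝ) (u₀ : V3), 0 < a → 0 < θ → ∃ σ₀ : ℝ, 0 < σ₀ ∧ ∀ σ : ℝ, 0 < σ → σ < σ₀ →
    (∀ (N : ℕ) (Φ : HardSphereFlow (Literature.Analysis.FluidPDE.Torus.geometry (Fin 3)) (hsDiameter σ N) (N + 1)),
      IsProbabilityMeasure (localGibbsLaw σ (fun _ => a) (fun _ => u₀) (fun _ => θ) N Φ)) ∧
    ∃ κ : ℝ, 0 < κ ∧ ∀ (φ : T3 → ℝ) (g : V3 → ℝ), Continuous φ → Continuous g → (∀ x, |φ x| ≤ 1) →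
      (∀ v, |g v| ≤ κ) →
      (∀ (c₀ c₂ : ℝ) (b : V3), ∫ v, g v * (c₀ + inner ℝ b v + c₂ * ‖v‖ ^ 2) ∂(stdGaussian V3) = 0) →
      ∀ δ : ℝ, 0 < δ → ∃ η : ℝ, 0 < η ∧ ∃ N₀ : ℕ, ∀ N : ℕ, N₀ ≤ N →
        ∀ Φ : HardSphereFlow (Literature.Analysis.FluidPDE.Torus.geometry (Fin 3)) (hsDiameter σ N) (N + 1),
        ∀ Q : Measure (Config (N + 1) (Fin 3) T3), IsProbabilityMeasure Q →
          InformationTheory.klDiv Q (localGibbsLaw σ (fun _ => a) (fun _ => u₀) (fun _ => θ) N Φ) ≠ ⊤ →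
          (∀ (f : Config (N + 1) (Fin 3) T3 → ℝ) (C : ℝ), Measurable f → (∀ z, |f z| ≤ C) →
            ∀ u : ℝ, 0 ≤ u →
              |(∫ z, f (Φ.flow u z) ∂Q) - ∫ z, f z ∂Q| ≤ η * (u * ((N + 1 : ℕ) : ℝ) ^ (1 / 3 : ℝ)) * C) →
          (∫ z, (∑ i, φ (z i).1 * g ((Real.sqrt θ)⁻¹ • ((z i).2 - u₀))) ∂Q) -
              (InformationTheory.klDiv Q
                (localGibbsLaw σ (fun _ => a) (fun _ => u₀) (fun _ => θ) N Φ)).toReal ≤ δ * (N + 1)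

/-! ## Plumbing lemmas -/

open scoped Classical in
/-- The piecewise flow preserves the homogeneous Gibbs law (it agrees with the flow `G_N`-a.e.). -/
theorem map_piecewise_flow_localGibbsLaw (σ a θ : ℝ) (u₀ : V3) (N : ℕ)
    (Φ : HardSphereFlow (Literature.Analysis.FluidPDE.Torus.geometry (Fin 3)) (hsDiameter σ N) (N + 1)) (t : ℝ) :
    (localGibbsLaw σ (fun _ => a) (fun _ => u₀) (fun _ => θ) N Φ).map
        (fun z => Φ.good.piecewise (Φ.flow t) id z) =
      localGibbsLaw σ (fun _ => a) (fun _ => u₀) (fun _ => θ) N Φ := by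
  have hae : (fun z => Φ.good.piecewise (Φ.flow t) id z) =ᵐ[localGibbsLaw σ (fun _ => a) (fun _ => u₀) (fun _ => θ) N Φ]
      Φ.flow t := by
    filter_upwards [Literature.MathematicalPhysics.KineticTheory.ae_mem_good_localGibbsLaw σ _ _ _ N Φ] with z hz
    exact Set.piecewise_eq_of_mem _ _ _ hz
  rw [Measure.map_congr hae]
  exact (Summit.AtomisticToContinuum.HydrodynamicLimit.Theorems.measurePreserving_flow_localGibbsLaw_const
    σ a θ u₀ N Φ t).map_eq

/-- Fubini for a bounded jointly measurable integrand against a probability law and the restricted Lebesgue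
measure on a window. -/
theorem integral_intervalIntegral_swap {X : Type*} [MeasurableSpace X] (μ : Measure X) [IsProbabilityMeasure μ]
    {H : ℝ × X → ℝ} (hH : Measurable H) {K : ℝ} (hK : ∀ p, |H p| ≤ K) {h : ℝ} (hh : 0 ≤ h) :
    ∫ x, (∫ s in (0 : ℝ)..h, H (s, x)) ∂μ = ∫ s in (0 : ℝ)..h, ∫ x, H (s, x) ∂μ := by
  simp only [intervalIntegral.integral_of_le hh]
  have hint : Integrable (Function.uncurry fun (s : ℝ) (x : X) => H (s, x))
      ((volume.restrict (Set.Ioc (0 : ℝ) h)).prod μ) := by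
    have hm : Measurable (Function.uncurry fun (s : ℝ) (x : X) => H (s, x)) :=
      hH.comp (measurable_fst.prodMk measurable_snd)
    refine Integrable.of_bound hm.aestronglyMeasurable K (ae_of_all _ fun p => ?_)
    rw [Real.norm_eq_abs]
    exact hK _
  exact (MeasureTheory.integral_integral_swap hint).symm

open scoped Classical in
/-- **Kifer's finite-volume upper bound** (registered stub `stub_reduction`, line `FirstLemma`): almost-stationary
dual decay implies the window LD decay `KineticFluxLdDecay` of stmt-10967 (hence the crux, by p99142). For `N ≥ N₀`
and a flow `Φ`, with `A` the (jointly measurable) window functional, `Q* = G_N.tilted A` and `Q̄ = Ψ_#(U ⊗ Q*)`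
its time average: `log ∫ e^{A} dG_N = ∫ A dQ* − KL(Q*‖G_N) = ∫ F dQ̄ − KL(Q*‖G_N) ≤ ∫ F dQ̄ − KL(Q̄‖G_N)`, and
`Q̄` is `(2/τ)`-almost stationary in microscopic time by the first lemma, so ASDD with `η = 2/τ` bounds the
right-hand side by `δ(N+1)`. -/
theorem stub_reduction : AlmostStationaryDualDecay → KineticFluxLdDecay := by
  intro hASDD a θ u₀ ha hθ
  obtain ⟨σ₀, hσ₀, hσ⟩ := hASDD a θ u₀ ha hθ
  refine ⟨σ₀, hσ₀, fun σ hσpos hσlt => ?_⟩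
  obtain ⟨hprob, κ, hκ, hmain⟩ := hσ σ hσpos hσlt
  refine ⟨hprob, κ, hκ, fun φ g hφ hg hφ1 hgκ horth δ hδ => ?_⟩
  obtain ⟨η, hη, N₀, hN⟩ := hmain φ g hφ hg hφ1 hgκ horth δ hδ
  refine ⟨2 / η, by positivity, N₀, fun N hNN Φ => ?_⟩
  -- notation
  set G : Measure (Config (N + 1) (Fin 3) T3) :=
    localGibbsLaw σ (fun _ => a) (fun _ => u₀) (fun _ => θ) N Φ with hGdef
  haveI hGprob : IsProbabilityMeasure G := hprob N Φ
  set ℓ : ℝ := ((N + 1 : ℕ) : ℝ) ^ (-(1 / 3 : ℝ)) with hℓ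
  have hNpos : (0 : ℝ) < ((N + 1 : ℕ) : ℝ) := by positivity
  have hℓpos : 0 < ℓ := Real.rpow_pos_of_pos hNpos _
  set hw : ℝ := 2 / η * ℓ with hhw_def
  have hhw : 0 < hw := by positivity
  set F : Config (N + 1) (Fin 3) T3 → ℝ :=
    fun z => ∑ i, φ (z i).1 * g ((Real.sqrt θ)⁻¹ • ((z i).2 - u₀)) with hFdef
  set Ψ : ℝ × Config (N + 1) (Fin 3) T3 → Config (N + 1) (Fin 3) T3 :=
    fun p => Φ.good.piecewise (Φ.flow p.1) id p.2 with hΨdef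
  have hΨm : Measurable Ψ := Literature.MathematicalPhysics.KineticTheory.measurable_piecewise_flow_torus Φ
  set A : Config (N + 1) (Fin 3) T3 → ℝ := fun z => hw⁻¹ * ∫ s in (0 : ℝ)..hw, F (Ψ (s, z)) with hAdef
  -- the window functional facts
  obtain ⟨hFm, hFb, hAm, hAb, hAgood⟩ := stub_windowFunctional Φ θ u₀ φ g κ hφ hg hφ1 hgκ hw hhw
  have hκ0 : 0 ≤ κ := hκ.le
  -- (1) replace the raw exponent by `A` (they agree on the good set, which is `G`-conull)
  have hgoodae : ∀ᵐ z ∂G, z ∈ Φ.good := Literature.MathematicalPhysics.KineticTheory.ae_mem_good_localGibbsLaw σ _ _ _ N Φ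
  have hraw : (fun z => ENNReal.ofReal (Real.exp (hw⁻¹ * ∫ s in (0 : ℝ)..hw,
      ∑ i, φ (Φ.flow s z i).1 * g ((Real.sqrt θ)⁻¹ • ((Φ.flow s z i).2 - u₀))))) =ᵐ[G]
      fun z => ENNReal.ofReal (Real.exp (A z)) := by
    filter_upwards [hgoodae] with z hz
    have h1 : A z = hw⁻¹ * ∫ s in (0 : ℝ)..hw, F (Φ.flow s z) := hAgood z hz
    simp only [h1, hFdef]
  rw [lintegral_congr_ae hraw]
  -- (2) `∫⁻ e^{A} = ofReal (∫ e^{A})`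
  have hexpAi : Integrable (fun z => Real.exp (A z)) G := by
    refine Integrable.of_bound (hAm.exp).aestronglyMeasurable (Real.exp (κ * (N + 1))) (ae_of_all _ fun z => ?_)
    rw [Real.norm_eq_abs, abs_of_pos (Real.exp_pos _)]
    exact Real.exp_le_exp.2 ((le_abs_self _).trans (hAb z))
  rw [← ofReal_integral_eq_lintegral_ofReal hexpAi (ae_of_all _ fun z => (Real.exp_pos _).le)]
  refine ENNReal.ofReal_le_ofReal ?_
  set Z : ℝ := ∫ z, Real.exp (A z) ∂G with hZdef
  have hZpos : 0 < Z := integral_exp_pos hexpAi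
  rw [← Real.log_le_iff_le_exp hZpos]
  -- (3) the tilt `Q* = G.tilted A`
  obtain ⟨hQprob, hQfin, hQkl⟩ := stub_tiltedKL G A (κ * (N + 1)) hAm hAb
  haveI : IsProbabilityMeasure (G.tilted A) := hQprob
  -- (4) the time average `Q̄`
  obtain ⟨hQbarprob, hQbarint, hQbarkl⟩ := stub_timeAveragedLaw Ψ hΨm (G.tilted A) hw hhw
  set Qbar : Measure (Config (N + 1) (Fin 3) T3) :=
    ((((ENNReal.ofReal hw⁻¹) • (volume.restrict (Set.Ioc (0 : ℝ) hw))).prod (G.tilted A)).map Ψ) with hQbar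
  haveI : IsProbabilityMeasure Qbar := hQbarprob
  have hinv : ∀ t : ℝ, G.map (fun z => Ψ (t, z)) = G := fun t =>
    map_piecewise_flow_localGibbsLaw σ a θ u₀ N Φ t
  have hKLmono : InformationTheory.klDiv Qbar G ≤ InformationTheory.klDiv (G.tilted A) G :=
    hQbarkl G hGprob hinv
  have hKLfin : InformationTheory.klDiv Qbar G ≠ ⊤ := ne_top_of_le_ne_top hQfin hKLmono
  -- (5) `∫ A dQ* = ∫ F dQ̄` (Fubini)
  have hgoodQ : ∀ᵐ z ∂(G.tilted A), z ∈ Φ.good := (tilted_absolutelyContinuous G A).ae_le hgoodae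
  have hAF : ∫ z, A z ∂(G.tilted A) = ∫ z, F z ∂Qbar := by
    rw [hQbarint F (κ * (N + 1)) hFm hFb]
    simp only [hAdef]
    rw [integral_const_mul]
    congr 1
    refine integral_intervalIntegral_swap (G.tilted A) (hFm.comp hΨm) (K := κ * (N + 1)) (fun p => hFb _) hhw.le
  -- (6) `Q̄` is `η`-almost stationary in microscopic time
  have hstat : ∀ (f : Config (N + 1) (Fin 3) T3 → ℝ) (C : ℝ), Measurable f → (∀ z, |f z| ≤ C) →
      ∀ u : ℝ, 0 ≤ u →
        |(∫ z, f (Φ.flow u z) ∂Qbar) - ∫ z, f z ∂Qbar| ≤ η * (u * ((N + 1 : ℕ) : ℝ) ^ (1 / 3 : ℝ)) * C := by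
    intro f C hf hfC u hu
    have hfu : Measurable fun z => f (Φ.flow u z) := hf.comp (Φ.measurable_flow u)
    rw [hQbarint (fun z => f (Φ.flow u z)) C hfu (fun z => hfC _), hQbarint f C hf hfC]
    -- `f (Φ_u (Ψ_t z)) = f (Ψ_{t+u} z)` for good `z`
    have hshift : ∀ t : ℝ, ∫ z, f (Φ.flow u (Ψ (t, z))) ∂(G.tilted A) =
        ∫ z, f (Φ.good.piecewise (Φ.flow (t + u)) id z) ∂(G.tilted A) := by
      intro t
      refine integral_congr_ae ?_
      filter_upwards [hgoodQ] with z hz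
      simp only [hΨdef, Set.piecewise_eq_of_mem _ _ _ hz]
      rw [show t + u = u + t from add_comm t u, Φ.flow_add u t z hz]
    simp_rw [hshift]
    have key := stub_almostStationaryTimeAverage (hsDiameter σ N) N Φ (G.tilted A) f C hf hfC hw u hhw hu
    have hΨt : ∀ t z, Φ.good.piecewise (Φ.flow t) id z = Ψ (t, z) := fun t z => rfl
    simp_rw [hΨt] at key
    refine key.trans (le_of_eq ?_)
    -- `2 u C / hw = η (u ℓ⁻¹) C`
    have hℓinv : ℓ⁻¹ = ((N + 1 : ℕ) : ℝ) ^ (1 / 3 : ℝ) := by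
      rw [hℓ, Real.rpow_neg hNpos.le, inv_inv]
    rw [← hℓinv, hhw_def]
    field_simp
  -- (7) apply ASDD to `Q̄`
  have hASDDQ := hN N hNN Φ Qbar hQbarprob hKLfin hstat
  -- (8) the chain of (in)equalities
  have hlogZ : Real.log Z = (∫ z, A z ∂(G.tilted A)) - (InformationTheory.klDiv (G.tilted A) G).toReal := by
    rw [hQkl]; ring
  have htoReal : (InformationTheory.klDiv Qbar G).toReal ≤ (InformationTheory.klDiv (G.tilted A) G).toReal :=
    ENNReal.toReal_mono hQfin hKLmono
  calc Real.log Z = (∫ z, F z ∂Qbar) - (InformationTheory.klDiv (G.tilted A) G).toReal := by rw [hlogZ, hAF]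
    _ ≤ (∫ z, F z ∂Qbar) - (InformationTheory.klDiv Qbar G).toReal := by linarith
    _ ≤ δ * (N + 1) := hASDDQ

open scoped Classical in
/-- **The converse (Donsker–Varadhan)**: the window LD decay of stmt-10967 implies almost-stationary dual decay.
For an `η`-almost-stationary `Q` with `KL(Q‖G_N) < ∞` and the window functional `A` (window `τℓ`):
`∫ F dQ − ητκ(N+1) ≤ ∫ A dQ ≤ KL(Q‖G_N) + log ∫ e^{A} dG_N ≤ KL(Q‖G_N) + (δ/2)(N+1)`; take `η = δ/(2τκ)`.
Together with `stub_reduction`: `AlmostStationaryDualDecay ↔ KineticFluxLdDecay` — the finite-`N` normal form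
carries exactly the content of the crux, so everything the line adds lives at `N = ∞`. -/
theorem almostStationaryDualDecay_of_kineticFluxLdDecay : KineticFluxLdDecay → AlmostStationaryDualDecay := by
  intro hK a θ u₀ ha hθ
  obtain ⟨σ₀, hσ₀, hσ⟩ := hK a θ u₀ ha hθ
  refine ⟨σ₀, hσ₀, fun σ hσpos hσlt => ?_⟩
  obtain ⟨hprob, κ, hκ, hmain⟩ := hσ σ hσpos hσlt
  refine ⟨hprob, κ, hκ, fun φ g hφ hg hφ1 hgκ horth δ hδ => ?_⟩
  obtain ⟨τ, hτ, N₀, hN⟩ := hmain φ g hφ hg hφ1 hgκ horth (δ / 2) (by positivity)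
  refine ⟨δ / (2 * τ * κ), by positivity, N₀, fun N hNN Φ Q hQprob hQfin hQstat => ?_⟩
  -- notation
  set G : Measure (Config (N + 1) (Fin 3) T3) :=
    localGibbsLaw σ (fun _ => a) (fun _ => u₀) (fun _ => θ) N Φ with hGdef
  haveI hGprob : IsProbabilityMeasure G := hprob N Φ
  have h10 := hN N hNN Φ
  set ℓ : ℝ := ((N + 1 : ℕ) : ℝ) ^ (-(1 / 3 : ℝ)) with hℓ
  have hNpos : (0 : ℝ) < ((N + 1 : ℕ) : ℝ) := by positivity
  have hℓpos : 0 < ℓ := Real.rpow_pos_of_pos hNpos _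
  set hw : ℝ := τ * ℓ with hhw_def
  have hhw : 0 < hw := by positivity
  set F : Config (N + 1) (Fin 3) T3 → ℝ :=
    fun z => ∑ i, φ (z i).1 * g ((Real.sqrt θ)⁻¹ • ((z i).2 - u₀)) with hFdef
  set Ψ : ℝ × Config (N + 1) (Fin 3) T3 → Config (N + 1) (Fin 3) T3 :=
    fun p => Φ.good.piecewise (Φ.flow p.1) id p.2 with hΨdef
  have hΨm : Measurable Ψ := Literature.MathematicalPhysics.KineticTheory.measurable_piecewise_flow_torus Φ
  set A : Config (N + 1) (Fin 3) T3 → ℝ := fun z => hw⁻¹ * ∫ s in (0 : ℝ)..hw, F (Ψ (s, z)) with hAdef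
  obtain ⟨hFm, hFb, hAm, hAb, hAgood⟩ := stub_windowFunctional Φ θ u₀ φ g κ hφ hg hφ1 hgκ hw hhw
  -- (1) the window bound of stmt-10967: `log ∫ e^{A} dG ≤ (δ/2)(N+1)`
  have hgoodae : ∀ᵐ z ∂G, z ∈ Φ.good := Literature.MathematicalPhysics.KineticTheory.ae_mem_good_localGibbsLaw σ _ _ _ N Φ
  have hraw : (fun z => ENNReal.ofReal (Real.exp (hw⁻¹ * ∫ s in (0 : ℝ)..hw,
      ∑ i, φ (Φ.flow s z i).1 * g ((Real.sqrt θ)⁻¹ • ((Φ.flow s z i).2 - u₀))))) =ᵐ[G]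
      fun z => ENNReal.ofReal (Real.exp (A z)) := by
    filter_upwards [hgoodae] with z hz
    have h1 : A z = hw⁻¹ * ∫ s in (0 : ℝ)..hw, F (Φ.flow s z) := hAgood z hz
    simp only [h1, hFdef]
  rw [lintegral_congr_ae hraw] at h10
  have hexpAi : Integrable (fun z => Real.exp (A z)) G := by
    refine Integrable.of_bound (hAm.exp).aestronglyMeasurable (Real.exp (κ * (N + 1))) (ae_of_all _ fun z => ?_)
    rw [Real.norm_eq_abs, abs_of_pos (Real.exp_pos _)]
    exact Real.exp_le_exp.2 ((le_abs_self _).trans (hAb z))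
  rw [← ofReal_integral_eq_lintegral_ofReal hexpAi (ae_of_all _ fun z => (Real.exp_pos _).le)] at h10
  have hZle : ∫ z, Real.exp (A z) ∂G ≤ Real.exp (δ / 2 * (N + 1)) :=
    (ENNReal.ofReal_le_ofReal_iff (Real.exp_pos _).le).1 h10
  have hZpos : 0 < ∫ z, Real.exp (A z) ∂G := integral_exp_pos hexpAi
  have hlogZ : Real.log (∫ z, Real.exp (A z) ∂G) ≤ δ / 2 * (N + 1) := by
    rw [← Real.log_exp (δ / 2 * (N + 1))]
    exact Real.log_le_log hZpos hZle
  -- (2) Donsker–Varadhan: `∫ A dQ ≤ KL(Q‖G) + log ∫ e^{A} dG`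
  haveI : IsProbabilityMeasure Q := hQprob
  have hDV : ∫ z, A z ∂Q ≤ (InformationTheory.klDiv Q G).toReal + Real.log (∫ z, Real.exp (A z) ∂G) :=
    Literature.Probability.Divergences.integral_le_toReal_klDiv_add_log hQfin hAm hAb
  -- (3) almost-stationarity: `∫ F dQ − (δ/2)(N+1) ≤ ∫ A dQ`
  have hQac : Q ≪ G := (InformationTheory.klDiv_ne_top_iff.1 hQfin).1
  have hgoodQ : ∀ᵐ z ∂Q, z ∈ Φ.good := hQac.ae_le hgoodae
  have hAQ : ∫ z, A z ∂Q = hw⁻¹ * ∫ s in (0 : ℝ)..hw, ∫ z, F (Ψ (s, z)) ∂Q := by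
    simp only [hAdef]
    rw [integral_const_mul]
    congr 1
    exact integral_intervalIntegral_swap Q (hFm.comp hΨm) (K := κ * (N + 1)) (fun p => hFb _) hhw.le
  have hℓinv : ℓ⁻¹ = ((N + 1 : ℕ) : ℝ) ^ (1 / 3 : ℝ) := by
    rw [hℓ, Real.rpow_neg hNpos.le, inv_inv]
  have hinner : ∀ s ∈ Set.Icc (0 : ℝ) hw,
      (∫ z, F z ∂Q) - δ / 2 * (N + 1) ≤ ∫ z, F (Ψ (s, z)) ∂Q := by
    intro s hs
    have h1 : ∫ z, F (Ψ (s, z)) ∂Q = ∫ z, F (Φ.flow s z) ∂Q := by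
      refine integral_congr_ae ?_
      filter_upwards [hgoodQ] with z hz
      simp only [hΨdef, Set.piecewise_eq_of_mem _ _ _ hz]
    have h2 := hQstat F (κ * (N + 1)) hFm hFb s hs.1
    have h3 : δ / (2 * τ * κ) * (s * ((N + 1 : ℕ) : ℝ) ^ (1 / 3 : ℝ)) * (κ * (N + 1)) ≤ δ / 2 * (N + 1) := by
      have hsτ : s * ((N + 1 : ℕ) : ℝ) ^ (1 / 3 : ℝ) ≤ τ := by
        rw [← hℓinv]
        calc s * ℓ⁻¹ ≤ hw * ℓ⁻¹ := mul_le_mul_of_nonneg_right hs.2 (inv_nonneg.2 hℓpos.le)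
          _ = τ := by rw [hhw_def]; field_simp
      calc δ / (2 * τ * κ) * (s * ((N + 1 : ℕ) : ℝ) ^ (1 / 3 : ℝ)) * (κ * (N + 1))
          ≤ δ / (2 * τ * κ) * τ * (κ * (N + 1)) := by
            gcongr
      _ = δ / 2 * (N + 1) := by field_simp
    rw [h1]
    have h4 := (abs_sub_le_iff.1 h2).2
    linarith
  have hAlow : (∫ z, F z ∂Q) - δ / 2 * (N + 1) ≤ ∫ z, A z ∂Q := by
    rw [hAQ]
    -- the time integrand is bounded and measurable, hence interval integrable
    have hjoint : Measurable fun p : ℝ × Config (N + 1) (Fin 3) T3 => F (Ψ (p.1, p.2)) := hFm.comp hΨm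
    have hu_meas : Measurable fun t : ℝ => ∫ z, F (Ψ (t, z)) ∂Q := by
      have : StronglyMeasurable (Function.uncurry fun (t : ℝ) (z : Config (N + 1) (Fin 3) T3) =>
          F (Ψ (t, z))) := hjoint.stronglyMeasurable
      exact (this.integral_prod_right' (ν := Q)).measurable
    have hu_bound : ∀ t, ‖∫ z, F (Ψ (t, z)) ∂Q‖ ≤ κ * (N + 1) := by
      intro t
      have h1 : ‖∫ z, F (Ψ (t, z)) ∂Q‖ ≤ κ * (N + 1) * (Q Set.univ).toReal := by
        refine norm_integral_le_of_norm_le_const ?_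
        exact Filter.Eventually.of_forall fun z => by
          rw [Real.norm_eq_abs]; exact hFb _
      simpa [measure_univ] using h1
    have hii : IntervalIntegrable (fun t : ℝ => ∫ z, F (Ψ (t, z)) ∂Q) volume 0 hw := by
      refine MeasureTheory.IntegrableOn.intervalIntegrable ?_
      refine Measure.integrableOn_of_bounded (μ := volume) (s := Set.uIcc 0 hw) (M := κ * (N + 1))
        isCompact_uIcc.measure_lt_top.ne hu_meas.aestronglyMeasurable ?_
      exact Filter.Eventually.of_forall fun t => hu_bound t
    have hmono : ∫ s in (0 : ℝ)..hw, ((∫ z, F z ∂Q) - δ / 2 * (N + 1)) ≤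
        ∫ s in (0 : ℝ)..hw, ∫ z, F (Ψ (s, z)) ∂Q :=
      intervalIntegral.integral_mono_on hhw.le intervalIntegrable_const hii hinner
    rw [intervalIntegral.integral_const, sub_zero, smul_eq_mul] at hmono
    have hwinv : hw⁻¹ * (hw * ((∫ z, F z ∂Q) - δ / 2 * (N + 1))) = (∫ z, F z ∂Q) - δ / 2 * (N + 1) := by
      field_simp
    rw [← hwinv]
    exact mul_le_mul_of_nonneg_left hmono (inv_nonneg.2 hhw.le)
  -- (4) conclusion
  have hfinal : (∫ z, F z ∂Q) - (InformationTheory.klDiv Q G).toReal ≤ δ * (N + 1) := by linarith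
  simpa [hFdef] using hfinal

/-- **The almost-stationary normal form of the wall**: `AlmostStationaryDualDecay ↔ KineticFluxLdDecay`
(Kifer's upper bound one way, Donsker–Varadhan the other). -/
theorem almostStationaryDualDecay_iff_kineticFluxLdDecay : AlmostStationaryDualDecay ↔ KineticFluxLdDecay :=
  ⟨stub_reduction, almostStationaryDualDecay_of_kineticFluxLdDecay⟩

/-- **The almost-stationary normal form of the crux**: `AlmostStationaryDualDecay ↔ CorrectorPressureDecay`, through
the landed `correctorPressureDecay_iff_kineticFluxLdDecay` (p99142). At finite `N` the line's dual object carries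
exactly the content of X; the line's only possible gain is at `N = ∞`. -/
theorem almostStationaryDualDecay_iff_correctorPressureDecay : AlmostStationaryDualDecay ↔ CorrectorPressureDecay :=
  almostStationaryDualDecay_iff_kineticFluxLdDecay.trans
    Summit.AtomisticToContinuum.HydrodynamicLimit.Theorems.CorrectorPressureDecayEquivalences.correctorPressureDecay_iff_kineticFluxLdDecay.symm

end Summit.AtomisticToContinuum.HydrodynamicLimit.Theorems.KiferCompactification
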